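import Literature.NumberTheory.Automorphic.UnitaryGroupHermitianSphereSection     -- ⊙ (F-sec): `continuous_hermForm` (+ ★ A-p10 `hermForm` API through it)
import Mathlib.Analysis.Seminorm
import Mathlib.Analysis.Normed.Module.FiniteDimension
import HarnessLib

/-!
# Eigenvectors of a compact family of operators, for eigenvalues in a compact set, lying on a hermitian sphere `{h(w,w) = β}`, `β ≠ 0`, form a COMPACT set —
# provided no such eigenvector is isotropic (N6nsGerm (S1), «compact mod M», file 2)

Topic `NumberTheory/Automorphic`; namespace `Literature.NumberTheory.Automorphic.UnitaryGroup`. KERNEL ONLY: theorems, no definition, no named fact, no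
instance, no notation, no `sorry`.  Cell `pub/hodgecm-mathlib` (LEAD F0P3a-plan (g9) T8-38 (1) ∕ T8-65 (2); road «N6nsGerm» (S1), binder (B4-top)(3)
«compact mod `M`»; census `F0/P3a/A-p16/g26/CENSUS-N6nsGerm-S1.A-p16g26.md` §5 road (F-eig)).

THE POINT.  For `x m x⁻¹ = ω ∈ Ω` with `m ∈ U_M` (windowed, `E₁`-eigenvalue `λ`), `x v₁` is a `λ`-eigenvector of `ω` of the fixed value `β = h(v₁, v₁)`.  Over a proper
non-trivially normed field `E` (the `L_w`), for `Ω ⊆ M_n(E)` COMPACT and `Λ ⊆ E` COMPACT, the set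
`W = {w ∣ h(w,w) = β, ∃ ω ∈ Ω, ∃ λ ∈ Λ, ω w = λ w}` is COMPACT as soon as (GUARD) no `ω ∈ Ω`, `λ ∈ Λ` has a non-zero ISOTROPIC `λ`-eigenvector:
CLOSED by projecting a closed relation along the compact `Ω × Λ`; BOUNDED because `|h(e,e)|` has a positive minimum `δ` over the compact set of shell-normalised
eigenvectors (`‖c‖⁻¹ ≤ ‖e‖ ≤ 1`, Mathlib `rescale_to_shell`), whence `‖w‖² ≤ ‖β‖ ∕ δ` up to the shell constant for `w ∈ W` (`σ` isometric).  With file 1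
(★∕⊙ `exists_isCompact_forall_mulVec_mem_imp`) this gives «`{x ∣ x U_M x⁻¹ ∩ Ω ≠ ∅} ⊆ C · M`» once the GUARD is supplied by the window (`λσλ = 1`, `λ` a simple root: file 3).

* §1 `hermForm_smul_smul` (`h(c•v, c•v) = σ(c)·c·h(v,v)`), `isClosed_setOf_exists_eigen` (projection along a compact factor).
* §2 **`isCompact_setOf_hermForm_eq_and_exists_eigen`** — the compactness of `W` under the GUARD.

HONEST SCOPE.  Point-set topology of finite-dimensional vector spaces over a proper valued field.  HC_CM is proved only modulo the printed citations until rung 0 closes; this file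
discharges no printed statement.

## References
* [HarishChandra1970] Harish-Chandra (notes by G. van Dijk), *Harmonic Analysis on Reductive p-adic Groups*, LNM 162 (1970), Part I §3 Lemma 19 ∕ Part II §5 (compactness modulo
  the centraliser).
* [Dieudonne1971GroupesClassiques] J. Dieudonné, *La géométrie des groupes classiques*, 3e éd. (1971), Chap. II §4 (hermitian spheres).
-/

set_option autoImplicit false

noncomputable section

open Set Filter Topology Matrix

namespace Literature.NumberTheory.Automorphic.UnitaryGroup

variable {E : Type*} [NontriviallyNormedField E] {n : Type*} [Fintype n] [DecidableEq n] (σ : E →+* E) (H : Matrix n n E)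

/-! ## §1 Scaling of the hermitian value; closedness of the eigen-relation set -/

/-- `h(c • v, c • v) = σ(c) · c · h(v, v)`. [cite: Dieudonne1971GroupesClassiques, Chap. II §4] -/
theorem hermForm_smul_smul (c : E) (v : n → E) : hermForm σ H (c • v) (c • v) = σ c * c * hermForm σ H v v := by
  rw [hermForm_smul_left_eq, hermForm_apply, hermForm_apply, Matrix.mulVec_smul, dotProduct_smul, smul_eq_mul, mul_assoc]

omit [DecidableEq n] in
/-- **The eigen-relation set is closed**: for compact `Ω ⊆ M_n(E)` and `Λ ⊆ E`, `{w ∣ ∃ ω ∈ Ω, ∃ λ ∈ Λ, ω w = λ w}` is closed (the relation `ω w = λ w` is closed and the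
projection along the compact `Ω × Λ` is a closed map). [cite: HarishChandra1970, Part I §3 Lemma 19] -/
theorem isClosed_setOf_exists_eigen {Ω : Set (Matrix n n E)} (hΩ : IsCompact Ω) {Λ : Set E} (hΛ : IsCompact Λ) :
    IsClosed {w : n → E | ∃ ω ∈ Ω, ∃ l ∈ Λ, ω *ᵥ w = l • w} := by
  haveI : CompactSpace ↥(Ω ×ˢ Λ) := isCompact_iff_compactSpace.1 (hΩ.prod hΛ)
  have hrel : IsClosed {p : ↥(Ω ×ˢ Λ) × (n → E) | (p.1 : Matrix n n E × E).1 *ᵥ p.2 = (p.1 : Matrix n n E × E).2 • p.2} := by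
    refine isClosed_eq ?_ ?_
    · exact ((continuous_fst.comp (continuous_subtype_val.comp continuous_fst)).matrix_mulVec continuous_snd)
    · exact ((continuous_snd.comp (continuous_subtype_val.comp continuous_fst)).smul continuous_snd)
  have himg : {w : n → E | ∃ ω ∈ Ω, ∃ l ∈ Λ, ω *ᵥ w = l • w} =
      Prod.snd '' {p : ↥(Ω ×ˢ Λ) × (n → E) | (p.1 : Matrix n n E × E).1 *ᵥ p.2 = (p.1 : Matrix n n E × E).2 • p.2} := by
    ext w
    constructor
    · rintro ⟨ω, hω, l, hl, h⟩
      exact ⟨(⟨(ω, l), ⟨hω, hl⟩⟩, w), h, rfl⟩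
    · rintro ⟨⟨⟨⟨ω, l⟩, ⟨hω, hl⟩⟩, w'⟩, h, hw⟩
      subst hw
      exact ⟨ω, hω, l, hl, h⟩
  rw [himg]
  exact isClosedMap_snd_of_compactSpace _ hrel

/-! ## §2 Compactness of the eigenvectors on a hermitian sphere under the anisotropy guard -/

/-- **EIGENVECTORS ON A HERMITIAN SPHERE FORM A COMPACT SET.** `E` a proper non-trivially normed field, `σ` continuous and isometric, `Ω ⊆ M_n(E)` and `Λ ⊆ E` compact,
`β ≠ 0`, and the GUARD «no `ω ∈ Ω`, `λ ∈ Λ` has a non-zero isotropic `λ`-eigenvector».  Then `{w ∣ h(w,w) = β ∧ ∃ ω ∈ Ω, ∃ λ ∈ Λ, ω w = λ w}` is compact (closed by §1;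
bounded since `|h|` is bounded below by `δ > 0` on shell-normalised eigenvectors, so `‖w‖ ≤ ‖c‖·(‖β‖∕δ)^{1∕2}`-type bound).
[cite: HarishChandra1970, Part I §3 Lemma 19; Part II §5] [cite: Dieudonne1971GroupesClassiques, Chap. II §4] -/
theorem isCompact_setOf_hermForm_eq_and_exists_eigen [ProperSpace E] (hσc : Continuous σ) (hσi : ∀ x, ‖σ x‖ = ‖x‖)
    {Ω : Set (Matrix n n E)} (hΩ : IsCompact Ω) {Λ : Set E} (hΛ : IsCompact Λ) {β : E} (hβ : β ≠ 0)
    (hguard : ∀ ω ∈ Ω, ∀ l ∈ Λ, ∀ e : n → E, ω *ᵥ e = l • e → hermForm σ H e e = 0 → e = 0) :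
    IsCompact {w : n → E | hermForm σ H w w = β ∧ ∃ ω ∈ Ω, ∃ l ∈ Λ, ω *ᵥ w = l • w} := by
  haveI : ProperSpace (n → E) := inferInstance
  -- closedness
  have hclosed : IsClosed {w : n → E | hermForm σ H w w = β ∧ ∃ ω ∈ Ω, ∃ l ∈ Λ, ω *ᵥ w = l • w} :=
    (isClosed_eq ((continuous_hermForm σ H hσc).comp (continuous_id.prodMk continuous_id)) continuous_const).inter
      (isClosed_setOf_exists_eigen hΩ hΛ)
  -- a scalar of norm `> 1`
  obtain ⟨c, hc⟩ := NormedField.exists_one_lt_norm E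
  -- the compact set of shell-normalised eigenvectors and the minimum `δ` of `‖h(e,e)‖` on it
  haveI : CompactSpace ↥(Ω ×ˢ Λ) := isCompact_iff_compactSpace.1 (hΩ.prod hΛ)
  set P : Set (↥(Ω ×ˢ Λ) × (n → E)) :=
    {p | (p.1 : Matrix n n E × E).1 *ᵥ p.2 = (p.1 : Matrix n n E × E).2 • p.2 ∧ ‖p.2‖ ≤ 1 ∧ 1 / ‖c‖ ≤ ‖p.2‖} with hP
  have hPc : IsCompact P := by
    have h1 : IsCompact (univ ×ˢ Metric.closedBall (0 : n → E) 1 : Set (↥(Ω ×ˢ Λ) × (n → E))) :=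
      isCompact_univ.prod (isCompact_closedBall 0 1)
    refine h1.of_isClosed_subset ?_ ?_
    · refine (isClosed_eq ?_ ?_).inter ((isClosed_le continuous_snd.norm continuous_const).inter (isClosed_le continuous_const continuous_snd.norm))
      · exact (continuous_fst.comp (continuous_subtype_val.comp continuous_fst)).matrix_mulVec continuous_snd
      · exact (continuous_snd.comp (continuous_subtype_val.comp continuous_fst)).smul continuous_snd
    · rintro ⟨p, e⟩ ⟨-, he1, -⟩
      exact mk_mem_prod (mem_univ _) (mem_closedBall_zero_iff.2 he1)
  have hfc : Continuous fun p : ↥(Ω ×ˢ Λ) × (n → E) => ‖hermForm σ H p.2 p.2‖ :=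
    ((continuous_hermForm σ H hσc).comp (continuous_snd.prodMk continuous_snd)).norm
  have hpos : ∀ p ∈ P, 0 < ‖hermForm σ H p.2 p.2‖ := by
    rintro ⟨⟨⟨ω, l⟩, hωl⟩, e⟩ ⟨heq, -, hlow⟩
    rw [norm_pos_iff]
    intro h0
    have he : e = 0 := hguard ω hωl.1 l hωl.2 e heq h0
    have hc1 : 0 < 1 / ‖c‖ := div_pos one_pos (lt_trans one_pos hc)
    rw [he, norm_zero] at hlow
    exact absurd hlow (not_le.2 hc1)
  -- the bound
  rw [Metric.isCompact_iff_isClosed_bounded]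
  refine ⟨hclosed, ?_⟩
  by_cases hne : P.Nonempty
  · obtain ⟨p₀, hp₀, hmin⟩ := hPc.exists_isMinOn hne hfc.continuousOn
    set δ : ℝ := ‖hermForm σ H p₀.2 p₀.2‖ with hδ
    have hδpos : 0 < δ := hpos p₀ hp₀
    -- every `w ∈ W` rescales into `P`, whence `‖w‖ ≤ ‖c‖ * √(‖β‖ / δ)`... we bound `‖w‖ ≤ R := (‖β‖ / δ) * ‖c‖ + 1`-free form via `‖d‖`
    refine (Metric.isBounded_closedBall (x := (0 : n → E)) (r := Real.sqrt (‖β‖ / δ))).subset ?_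
    rintro w ⟨hwβ, ω, hω, l, hl, hwl⟩
    rw [mem_closedBall_zero_iff]
    have hw0 : w ≠ 0 := by
      rintro rfl
      rw [hermForm_zero_left] at hwβ
      exact hβ hwβ.symm
    obtain ⟨d, hd0, hd1, hdlow, -⟩ := rescale_to_shell hc one_pos hw0
    have hmem : (⟨(ω, l), ⟨hω, hl⟩⟩, d • w) ∈ P := by
      refine ⟨?_, hd1.le, hdlow⟩
      show ω *ᵥ (d • w) = l • (d • w)
      rw [Matrix.mulVec_smul, hwl, smul_comm]
    have hge : δ ≤ ‖hermForm σ H (d • w) (d • w)‖ := hmin hmem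
    rw [hermForm_smul_smul, hwβ, norm_mul, norm_mul, hσi] at hge
    -- `δ ≤ ‖d‖² ‖β‖` and `‖d • w‖ ≤ 1` ⇒ `‖w‖ ≤ 1/‖d‖ ≤ √(‖β‖/δ)`
    have hdpos : 0 < ‖d‖ := norm_pos_iff.2 hd0
    have hβpos : 0 < ‖β‖ := norm_pos_iff.2 hβ
    have hd2 : δ / ‖β‖ ≤ ‖d‖ ^ 2 := by
      rw [div_le_iff₀ hβpos, pow_two]
      exact hge
    have hdge : Real.sqrt (δ / ‖β‖) ≤ ‖d‖ := by
      rw [← Real.sqrt_sq hdpos.le]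
      exact Real.sqrt_le_sqrt hd2
    have hsqpos : 0 < Real.sqrt (δ / ‖β‖) := Real.sqrt_pos.2 (div_pos hδpos hβpos)
    have hw1 : ‖d‖ * ‖w‖ ≤ 1 := by rw [← norm_smul]; exact hd1.le
    calc ‖w‖ ≤ 1 / ‖d‖ := by rw [le_div_iff₀ hdpos, mul_comm]; exact hw1
      _ ≤ 1 / Real.sqrt (δ / ‖β‖) := one_div_le_one_div_of_le hsqpos hdge
      _ = Real.sqrt (‖β‖ / δ) := by
        rw [one_div, ← Real.sqrt_inv, inv_div]
  · -- `P = ∅`: then `W = ∅`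
    refine (Bornology.isBounded_empty).subset ?_
    rintro w ⟨hwβ, ω, hω, l, hl, hwl⟩
    have hw0 : w ≠ 0 := by
      rintro rfl
      rw [hermForm_zero_left] at hwβ
      exact hβ hwβ.symm
    obtain ⟨d, hd0, hd1, hdlow, -⟩ := rescale_to_shell hc one_pos hw0
    exact hne ⟨(⟨(ω, l), ⟨hω, hl⟩⟩, d • w), by
      refine ⟨?_, hd1.le, hdlow⟩
      show ω *ᵥ (d • w) = l • (d • w)
      rw [Matrix.mulVec_smul, hwl, smul_comm]⟩

end Literature.NumberTheory.Automorphic.UnitaryGroup
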